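import Literature.NumberTheory.EllipticCurves.Satge1987.CubeSumTwicePrimesRank
import Literature.NumberTheory.EllipticCurves.CaiShuTian2017.CubeSumTwicePrimes
import Literature.NumberTheory.EllipticCurves.BSDInvariantsProofs
import Literature.NumberTheory.EllipticCurves.CanonicalPAdicHeightJunkSigmaProofs
import Literature.NumberTheory.EllipticCurves.Rank1Residual.X12SexticTwistTransport
import HarnessLib

/-!
# Satgé 1987 §3, PROVED consequences — "une infinité de points rationnels", `2p` / `2p²` are sums of two non-zero rational cubes, and the rank statement on Kezuka–Li's model `y² = x³ − 27p^{2j}`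

Companion of the STATEMENT-ONLY file `Satge1987/CubeSumTwicePrimesRank.lean` (Satgé, Invent.
Math. 87 (1987), Thm. 3.1 / Prop. 3.3, named facts `thm31_rank_cubeSum_twicePrime`,
`prop33_ratPoint_twicePrime_cubic`). Everything here is a `theorem` with a proof; the only
displayed hypothesis is Satgé's Thm. 3.1 itself (`h : thm31_rank_cubeSum_twicePrime`). Nothing
new is asserted; no fact is minted (D-0026).

What is proved (cell `bsd-print-cf2`, typer seat `ty1`):
* `cubicHasRatPoint_of_ne_zero` — introduction rule for the vocabulary `CubicHasRatPoint` (a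
  solution with `W ≠ 0` is a projective rational point; the shape of Satgé's points `V = 1`).
* `infinite_point_of_thm31` — the form announced in Satgé's Introduction (p. 425): "la courbe
  elliptique `X³ + Y³ = 2pZ³` [resp. `2p²Z³`] possède une infinité de points rationnels"
  (rank `1 ≠ 0` ⇒ a point of infinite order ⇒ `n ↦ n • P` injective).
* `isCubeSum_of_thm31` — the cube-sum form: for an odd prime `p ≡ 2 mod 9`, `2p` is a sum of two
  non-zero rational cubes; for `p ≡ 5 mod 9`, `2p²` (equivalently `2/p`, Cai–Shu–Tian's `2p*⁻¹`
  normalisation) is — in the tree's vocabulary `CaiShuTian2017.IsCubeSum` (the conclusion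
  "`2p*` is a cube sum" of `CaiShuTian2017.thm12_bsd_cubeSum_twicePrime`, here from the 1987
  source: a point of infinite order on `y² = x³ − 432n²` is affine, maps to `x³ + y³ = n` by
  `x = (36n + Y)/(6X)`, `y = (36n − Y)/(6X)` (Dasgupta–Voight 2018 §1.1), and neither cube can
  vanish because `2p`, `2p²` are not rational cubes — `ord_p = 1, 2 ∉ 3ℤ`).
* `mordellWeilRank_cubeSumTwoModel_of_thm31` — Thm. 3.1 transported to Kezuka–Li's model (4.1)
  `cubeSumTwoModel p j : y² = x³ − 27p^{2j}` (the model of the tree's Cai–Shu–Tian 2017 /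
  Kezuka–Li 2020 facts) by the change of variables `u = 2` (`(x, y) ↦ (4x, 8y)`, the tree's
  `X12SexticTwist.scaleTwo`; `scaleTwo_smul_mordellCurve_two_mul`) and the PROVED invariance
  `mordellWeilRank_variableChange_holds`: `rank (cubeSumTwoModel p 1) = 1` for `p ≡ 2 mod 9`,
  `rank (cubeSumTwoModel p 2) = 1` for `p ≡ 5 mod 9` — literally the Mordell–Weil conjunct
  `W.mordellWeilRank = 1` of Cai–Shu–Tian 2017 Thm. 1.2 / Kezuka–Li 2020 Thm. 1.3 at the named
  model, thirty years earlier and without Gross–Zagier–Kolyvagin.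

References: [Satge1987] Introduction p. 425, Thm. 3.1 p. 438; [DasguptaVoight2018] §1.1 (the
model link); [KezukaLi2020] (4.1) p. 2139; [CaiShuTian2017] §1; [SilvermanAEC2009] III.3.1(b),
VIII.6.7.
-/

noncomputable section

open scoped Classical

open WeierstrassCurve Literature.NumberTheory.EllipticCurves
  Literature.NumberTheory.EllipticCurves.KezukaLi2020
  Literature.NumberTheory.EllipticCurves.CaiShuTian2017
  Literature.NumberTheory.EllipticCurves.Rank1Residual.X12SexticTwist

namespace Literature.NumberTheory.EllipticCurves.Satge1987

/-! ### §1. Vocabulary API -/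

/-- A solution of `w³ = a u³ + b v³` with `w ≠ 0` is a rational point of the projective cubic
`W³ = aU³ + bV³` (the form in which Satgé exhibits his points: `V = 1`, `W = 2f₁(pρ)/∛4`).
[cite: Satge1987, Prop. 3.3 (p. 438), proof] -/
theorem cubicHasRatPoint_of_ne_zero {a b u v w : ℚ} (hw : w ≠ 0)
    (h : w ^ 3 = a * u ^ 3 + b * v ^ 3) : CubicHasRatPoint a b :=
  ⟨u, v, w, fun h0 => hw (Prod.mk.inj (Prod.mk.inj h0).2).2, h⟩

/-! ### §2. Infinitely many rational points (the Introduction's form of Thm. 3.1) -/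

/-- A Weierstrass curve over `ℚ` of Mordell–Weil rank `1` has infinitely many rational points
(a point `P` of infinite order, `WeierstrassCurve.exists_not_isOfFinAddOrder_of_mordellWeilRank_ne_zero`,
and `n ↦ n • P` is injective). [cite: SilvermanAEC2009, VIII.6.7] -/
theorem infinite_point_of_mordellWeilRank_eq_one {W : WeierstrassCurve ℚ}
    (hr : W.mordellWeilRank = 1) : Infinite W.toAffine.Point := by
  obtain ⟨P, hP⟩ :=
    exists_not_isOfFinAddOrder_of_mordellWeilRank_ne_zero (W := W) (by rw [hr]; exact one_ne_zero)
  exact Infinite.of_injective (fun n : ℤ => n • P) (injective_zsmul_iff_not_isOfFinAddOrder.mpr hP)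

/-- **Satgé 1987, Introduction (p. 425) ⟸ Thm. 3.1**: "si `p` est un nombre premier impair congru
à `2` modulo `9`, la courbe elliptique `X³ + Y³ = 2pZ³` possède une infinité de points
rationnels", and "si `p` est un nombre premier congru à `5` modulo `9`, la courbe elliptique
`X³ + Y³ = 2p²Z³` possède une infinité de points rationnels" — on the model `y² = x³ − 432 n²`.
[cite: Satge1987, Introduction (p. 425), Thm. 3.1 (p. 438)] -/
theorem infinite_point_of_thm31 (h : thm31_rank_cubeSum_twicePrime) {p : ℕ} (hp : p.Prime)
    (hp2 : p ≠ 2) :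
    (p % 9 = 2 → Infinite (mordellCurve (-(432 * (2 * (p : ℚ)) ^ 2))).toAffine.Point) ∧
    (p % 9 = 5 → Infinite (mordellCurve (-(432 * (2 * (p : ℚ) ^ 2) ^ 2))).toAffine.Point) :=
  ⟨fun h9 => infinite_point_of_mordellWeilRank_eq_one ((h p hp hp2).1 h9),
    fun h9 => infinite_point_of_mordellWeilRank_eq_one ((h p hp hp2).2 h9)⟩

/-! ### §3. The cube-sum form: `2p`, `2p²` (and `2/p`) are sums of two non-zero rational cubes -/

/-- An affine point `(X, Y)` of `y² = x³ − 432 n²` (`n ≠ 0`) gives `x³ + y³ = n` with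
`x = (36n + Y)/(6X)`, `y = (36n − Y)/(6X)` (`X ≠ 0` since `Y² = −432n² < 0` is impossible).
Same computation as the tree's `exists_cube_add_cube_of_mordellCurve_equation`
(`Kriz2020/SylvesterProofs`), re-proved here to keep this file's imports light.
[cite: DasguptaVoight2018, §1.1] -/
private theorem exists_cube_add_cube_of_equation {n X Y : ℚ} (hn : n ≠ 0)
    (h : (mordellCurve (-(432 * n ^ 2))).toAffine.Equation X Y) :
    ∃ x y : ℚ, x ^ 3 + y ^ 3 = n := by
  have heq : Y ^ 2 = X ^ 3 - 432 * n ^ 2 := by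
    rw [Affine.equation_iff] at h
    simp only [mordellCurve] at h
    linear_combination h
  have hX : X ≠ 0 := by
    rintro rfl
    have h1 : (0 : ℚ) ≤ Y ^ 2 := sq_nonneg Y
    have h2 : (0 : ℚ) < 432 * n ^ 2 := by positivity
    have h3 : Y ^ 2 = -(432 * n ^ 2) := by rw [heq]; ring
    linarith
  refine ⟨(36 * n + Y) / (6 * X), (36 * n - Y) / (6 * X), ?_⟩
  have h6 : (6 * X) ≠ 0 := mul_ne_zero (by norm_num) hX
  field_simp
  linear_combination (216 * n) * heq

/-- A Weierstrass curve `y² = x³ − 432 n²` (`n ≠ 0`) of Mordell–Weil rank `1` yields a solution of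
`x³ + y³ = n` in rationals (a point of infinite order is affine). [cite: DasguptaVoight2018, §1.1]
[cite: SilvermanAEC2009, VIII.6.7] -/
theorem exists_cube_add_cube_of_mordellWeilRank_eq_one {n : ℚ} (hn : n ≠ 0)
    (hr : (mordellCurve (-(432 * n ^ 2))).mordellWeilRank = 1) :
    ∃ x y : ℚ, x ^ 3 + y ^ 3 = n := by
  obtain ⟨P, hP⟩ := exists_not_isOfFinAddOrder_of_mordellWeilRank_ne_zero
    (W := mordellCurve (-(432 * n ^ 2))) (by rw [hr]; exact one_ne_zero)
  rcases P with _ | ⟨X, Y, hXY⟩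
  · exact absurd (by rw [← Affine.Point.zero_def]; exact IsOfFinAddOrder.zero) hP
  · exact exists_cube_add_cube_of_equation hn hXY.1

/-- `2 p^j` (`p` an odd prime, `j = 1, 2`) is not the cube of a rational number: its `p`-adic
valuation `j` is not a multiple of `3`. [folklore] -/
private theorem pow_three_ne_two_mul_prime_pow {p : ℕ} (hp : p.Prime) (hp2 : p ≠ 2) {j : ℕ}
    (hj : j = 1 ∨ j = 2) (y : ℚ) : y ^ 3 ≠ 2 * (p : ℚ) ^ j := by
  intro hy
  haveI : Fact p.Prime := ⟨hp⟩
  have hp0 : (p : ℚ) ≠ 0 := by exact_mod_cast hp.ne_zero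
  have hy0 : y ≠ 0 := by
    rintro rfl
    have : (2 : ℚ) * (p : ℚ) ^ j = 0 := by rw [← hy]; ring
    exact (mul_ne_zero (by norm_num) (pow_ne_zero _ hp0)) this
  have hv := congrArg (padicValRat p) hy
  rw [padicValRat.pow y, padicValRat.mul (by norm_num) (pow_ne_zero _ hp0),
    padicValRat.pow (p : ℚ), padicValRat.self hp.one_lt] at hv
  have h2 : padicValRat p (2 : ℚ) = 0 := by
    have hnd : ¬ p ∣ 2 := fun hdvd => hp2 ((Nat.prime_dvd_prime_iff_eq hp Nat.prime_two).1 hdvd)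
    have h20 : padicValNat p 2 = 0 := padicValNat.eq_zero_of_not_dvd hnd
    have h2' : padicValRat p ((2 : ℕ) : ℚ) = padicValNat p 2 := padicValRat.of_nat
    rw [Nat.cast_ofNat] at h2'
    rw [h2', h20, Nat.cast_zero]
  rw [h2] at hv
  push_cast at hv
  rcases hj with rfl | rfl <;> omega

/-- From `x³ + y³ = 2p^j` (`j = 1, 2`, `p` odd prime) both `x` and `y` are non-zero, so `2p^j` is a
"cube sum" in Cai–Shu–Tian's sense. [cite: CaiShuTian2017, §1 (the definition of a cube sum)] -/
private theorem isCubeSum_of_cube_add_cube {p : ℕ} (hp : p.Prime) (hp2 : p ≠ 2) {j : ℕ}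
    (hj : j = 1 ∨ j = 2) {x y : ℚ} (h : x ^ 3 + y ^ 3 = 2 * (p : ℚ) ^ j) :
    IsCubeSum (2 * (p : ℚ) ^ j) := by
  have hp0 : (p : ℚ) ≠ 0 := by exact_mod_cast hp.ne_zero
  refine ⟨mul_ne_zero (by norm_num) (pow_ne_zero _ hp0), x, y, ?_, ?_, h⟩
  · rintro rfl
    exact pow_three_ne_two_mul_prime_pow hp hp2 hj y (by rw [← h]; ring)
  · rintro rfl
    exact pow_three_ne_two_mul_prime_pow hp hp2 hj x (by rw [← h]; ring)

/-- **The cube-sum form of Satgé's Thm. 3.1**: for an odd prime `p ≡ 2 mod 9`, `2p` is a sum of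
two non-zero rational cubes; for `p ≡ 5 mod 9`, `2p²` is — `CaiShuTian2017.IsCubeSum (2p)` resp.
`IsCubeSum (2p²)` (the Diophantine content of "`X³ + Y³ = 2pZ³` possède une infinité de points
rationnels"; Satgé's [16] is titled "les entiers qui [sont] somme des cubes de deux rationnels").
[cite: Satge1987, Thm. 3.1 (p. 438), Introduction (p. 425)] [cite: CaiShuTian2017, §1] -/
theorem isCubeSum_of_thm31 (h : thm31_rank_cubeSum_twicePrime) {p : ℕ} (hp : p.Prime)
    (hp2 : p ≠ 2) :
    (p % 9 = 2 → IsCubeSum (2 * (p : ℚ))) ∧ (p % 9 = 5 → IsCubeSum (2 * (p : ℚ) ^ 2)) := by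
  have hp0 : (p : ℚ) ≠ 0 := by exact_mod_cast hp.ne_zero
  refine ⟨fun h9 => ?_, fun h9 => ?_⟩
  · obtain ⟨x, y, hxy⟩ := exists_cube_add_cube_of_mordellWeilRank_eq_one
      (mul_ne_zero two_ne_zero hp0) ((h p hp hp2).1 h9)
    have := isCubeSum_of_cube_add_cube hp hp2 (Or.inl rfl) (x := x) (y := y) (by rw [hxy]; ring)
    simpa using this
  · obtain ⟨x, y, hxy⟩ := exists_cube_add_cube_of_mordellWeilRank_eq_one
      (mul_ne_zero two_ne_zero (pow_ne_zero 2 hp0)) ((h p hp hp2).2 h9)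
    exact isCubeSum_of_cube_add_cube hp hp2 (Or.inr rfl) hxy

/-- **Cai–Shu–Tian's normalisation of case (ii)**: for `p ≡ 5 mod 9`, `2p* = 2/p` is a cube sum
(`x³ + y³ = 2p²` divided by the cube `p³`) — the clause `IsCubeSum (2 / p)` of
`CaiShuTian2017.thm12_bsd_cubeSum_twicePrime`, here from Satgé's Thm. 3.1.
[cite: Satge1987, Thm. 3.1 (ii) (p. 438)] [cite: CaiShuTian2017, Thm. 1.2] -/
theorem isCubeSum_two_div_of_thm31 (h : thm31_rank_cubeSum_twicePrime) {p : ℕ} (hp : p.Prime)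
    (hp2 : p ≠ 2) (h9 : p % 9 = 5) : IsCubeSum (2 / (p : ℚ)) := by
  have hp0 : (p : ℚ) ≠ 0 := by exact_mod_cast hp.ne_zero
  obtain ⟨-, x, y, hx, hy, hxy⟩ := (isCubeSum_of_thm31 h hp hp2).2 h9
  refine ⟨div_ne_zero two_ne_zero hp0, x / p, y / p, div_ne_zero hx hp0, div_ne_zero hy hp0, ?_⟩
  rw [div_pow, div_pow, ← add_div, hxy, div_eq_div_iff (pow_ne_zero 3 hp0) hp0]
  ring

/-! ### §4. Thm. 3.1 on Kezuka–Li's model `cubeSumTwoModel p j : y² = x³ − 27p^{2j}` -/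

/-- Satgé's model of `X³ + Y³ = 2p^j Z³` (`y² = x³ − 432 (2p^j)²`) is carried by the scaling
`u = 2` (`(x, y) ↦ (4x, 8y)`; the tree's `X12SexticTwist.scaleTwo`, `a₆ ↦ a₆/64`) to
Kezuka–Li's model (4.1) `y² = x³ − 27 p^{2j}` (`432 · 4 / 64 = 27`).
[cite: KezukaLi2020, (4.1) (p. 2139)] [cite: Satge1986, p. 295] -/
theorem scaleTwo_smul_mordellCurve_two_mul (p j : ℕ) :
    scaleTwo • mordellCurve (-(432 * (2 * (p : ℚ) ^ j) ^ 2)) = cubeSumTwoModel p j := by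
  simp only [mordellCurve, cubeSumTwoModel, scaleTwo_smul]
  congr 1
  ring

/-- **Satgé's Thm. 3.1 on Kezuka–Li's model**: for an odd prime `p`, `rank (cubeSumTwoModel p 1)
= 1` if `p ≡ 2 mod 9` and `rank (cubeSumTwoModel p 2) = 1` if `p ≡ 5 mod 9` — the Mordell–Weil
rank is invariant under the change of variables `scaleTwo`
(`mordellWeilRank_variableChange_holds`, PROVED). This is the conjunct `W.mordellWeilRank = 1` of
`CaiShuTian2017.thm12_bsd_cubeSum_twicePrime` / `KezukaLi2020.thm13_sha_two_iff_twoRank` at the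
named model, from the 1987 source. [cite: Satge1987, Thm. 3.1 (p. 438)]
[cite: KezukaLi2020, (4.1) (p. 2139) and p. 2115] [cite: SilvermanAEC2009, III.3.1(b)] -/
theorem mordellWeilRank_cubeSumTwoModel_of_thm31 (h : thm31_rank_cubeSum_twicePrime) {p : ℕ}
    (hp : p.Prime) (hp2 : p ≠ 2) :
    (p % 9 = 2 → (cubeSumTwoModel p 1).mordellWeilRank = 1) ∧
    (p % 9 = 5 → (cubeSumTwoModel p 2).mordellWeilRank = 1) := by
  refine ⟨fun h9 => ?_, fun h9 => ?_⟩
  · have hr := (h p hp hp2).1 h9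
    have hC := mordellWeilRank_variableChange_holds (mordellCurve (-(432 * (2 * (p : ℚ)) ^ 2)))
      scaleTwo
    have key := scaleTwo_smul_mordellCurve_two_mul p 1
    rw [pow_one] at key
    rw [mordellWeilRank_variableChange, key] at hC
    rw [hC, hr]
  · have hr := (h p hp hp2).2 h9
    have hC := mordellWeilRank_variableChange_holds
      (mordellCurve (-(432 * (2 * (p : ℚ) ^ 2) ^ 2))) scaleTwo
    rw [mordellWeilRank_variableChange, scaleTwo_smul_mordellCurve_two_mul p 2] at hC
    rw [hC, hr]

/-- **Rank-one membership of the even cube-sum curves, by name from 1987** — the form consumed by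
the cell's cube-sum files (any `W` that is `ℚ`-isomorphic to Kezuka–Li's model has rank `1`):
`∃ C, C • W = cubeSumTwoModel p j` ⇒ `W.mordellWeilRank = 1` for `(p mod 9, j) ∈ {(2,1), (5,2)}`.
[cite: Satge1987, Thm. 3.1 (p. 438)] [cite: SilvermanAEC2009, III.3.1(b)] -/
theorem mordellWeilRank_eq_one_of_smul_eq_cubeSumTwoModel (h : thm31_rank_cubeSum_twicePrime)
    {p : ℕ} (hp : p.Prime) (hp2 : p ≠ 2) {j : ℕ} (hj : (p % 9 = 2 ∧ j = 1) ∨ (p % 9 = 5 ∧ j = 2))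
    {W : WeierstrassCurve ℚ} (hW : ∃ C : VariableChange ℚ, C • W = cubeSumTwoModel p j) :
    W.mordellWeilRank = 1 := by
  obtain ⟨C, hC⟩ := hW
  have hinv := mordellWeilRank_variableChange_holds W C
  rw [mordellWeilRank_variableChange, hC] at hinv
  rw [← hinv]
  rcases hj with ⟨h9, rfl⟩ | ⟨h9, rfl⟩
  · exact (mordellWeilRank_cubeSumTwoModel_of_thm31 h hp hp2).1 h9
  · exact (mordellWeilRank_cubeSumTwoModel_of_thm31 h hp hp2).2 h9

end Literature.NumberTheory.EllipticCurves.Satge1987
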